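import Literature.Geometry.Symplectic.SphereCRFamilySolutions
import HarnessLib

/-!
# From the implicit-function family to the chart-level deformation core

Layer B6 of the analytic core of the Hofer–Lizan–Sikorav local foliation theorem (Wendl 2018,
Thm. 2.46; lead of crux `WitnessCharge`, summit `SmoothPoincare4`). The MANIFOLD-SIDE packaging
of the deformation family (the registered helper `helper_deformationFamily_of_core` of the crux)
consumes, for each `𝒥 : SphereACData`, the following CHART-LEVEL CORE (`CoreFor 𝒥`): an
`ε > 0` and four functions `Ξ₀ Ξ₁ Φ₀ Φ₁ : ℂ → ℂ → ℂ` (the two chart representatives of the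
tangent section `ξₐ` and of the function `fₐ`, `a ∈ ball 0 ε`) which vanish at `a = 0`, clutch
(`Ξ₁ a w = -w² Ξ₀ a w⁻¹`, `Φ₁ a w = Φ₀ a w⁻¹`), are jointly `C^∞` on `ball 0 ε × ℂ`, are small and
solve the Cauchy–Riemann equations `crExpr 𝒥.Jᵢ (𝒥.vmapᵢ (Ξᵢ a) (Φᵢ a)) = 0` on the discs of
radius `2`, and satisfy the border condition `Φ₀ a 0 = a`.

Here we derive `CoreFor 𝒥` from a family `γ : ball 0 ε → SecPair k r` as produced by
`SphereCRFamily.exists_family` — `γ 0 = 0`, continuity at `0`, smallness, `FT (γ a) = FN (γ a) = 0`,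
`(γ a).2 (0) = a` — TOGETHER WITH the joint smoothness of the four representatives in `(a, z)`
(the output of the bootstrapping layer B7): `coreFor_of_family`. The Cauchy–Riemann equations
follow from `FT = FN = 0` through `out₀ = out₁ = 0`, `crOp₀ = crOp₁ = 0` on the discs of radius
`3`, and the invertibility of the transports for small jets (`exists_pos_isUnit_PhiJet₀/₁`),
after shrinking `ε` by continuity of `γ` at `0`.

## References

* C. Wendl, *Holomorphic Curves in Low Dimensions*, LNM 2216 (2018), §2.3, Thm. 2.46. [Wendl2018]
-/

noncomputable section

open Set Filter Metric Function Complex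
open scoped Topology NNReal ContDiff
open Literature.Analysis.FunctionSpaces Literature.Analysis.Complex.RiemannSphere
open Literature.Analysis.Complex.ProjectiveLineExpChart Literature.Geometry.Symplectic.CRExpression
open Literature.Analysis.Complex Literature.Analysis.Calculus

namespace Literature.Geometry.Symplectic

namespace SphereCR

namespace SphereACData

variable (𝒥 : SphereACData)

/-- **The chart-level deformation core for `𝒥`** (the hypothesis of the crux helper
`helper_deformationFamily_of_core`, for one `𝒥`). [cite: Wendl2018, Thm. 2.46] -/
def CoreFor : Prop :=
  ∃ (ε : ℝ) (Ξ₀ Ξ₁ Φ₀ Φ₁ : ℂ → ℂ → ℂ), 0 < ε ∧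
    (∀ z : ℂ, Ξ₀ 0 z = 0 ∧ Φ₀ 0 z = 0 ∧ Ξ₁ 0 z = 0 ∧ Φ₁ 0 z = 0) ∧
    (∀ a : ℂ, ‖a‖ < ε → ∀ w : ℂ, w ≠ 0 → Ξ₁ a w = -w ^ 2 * Ξ₀ a w⁻¹ ∧ Φ₁ a w = Φ₀ a w⁻¹) ∧
    ContDiffOn ℝ ∞ (fun q : ℂ × ℂ => Ξ₀ q.1 q.2) (Metric.ball 0 ε ×ˢ Set.univ) ∧
    ContDiffOn ℝ ∞ (fun q : ℂ × ℂ => Ξ₁ q.1 q.2) (Metric.ball 0 ε ×ˢ Set.univ) ∧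
    ContDiffOn ℝ ∞ (fun q : ℂ × ℂ => Φ₀ q.1 q.2) (Metric.ball 0 ε ×ˢ Set.univ) ∧
    ContDiffOn ℝ ∞ (fun q : ℂ × ℂ => Φ₁ q.1 q.2) (Metric.ball 0 ε ×ˢ Set.univ) ∧
    (∀ a : ℂ, ‖a‖ < ε →
      (∀ z : ℂ, ‖z‖ ≤ 2 → ‖Ξ₀ a z‖ < 2⁻¹ ∧ crExpr 𝒥.J₀ (𝒥.vmap₀ (Ξ₀ a) (Φ₀ a)) z = 0) ∧
      (∀ w : ℂ, ‖w‖ ≤ 2 → ‖Ξ₁ a w‖ < 2⁻¹ ∧ crExpr 𝒥.J₁ (𝒥.vmap₁ (Ξ₁ a) (Φ₁ a)) w = 0)) ∧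
    (∀ a : ℂ, ‖a‖ < ε → Φ₀ a 0 = a)

variable {r : ℝ≥0} {k : ℕ}

/-- **The chart-level core from the implicit-function family plus joint smoothness.** Let
`γ : ℂ → SecPair k r` (`k ≥ 1`, `0 < r < 1`) with `γ 0 = 0`, continuous at `0`, and for
`‖a‖ < ε`: `γ a` small, `FT (γ a) = 0`, `FN (γ a) = 0`, `(γ a).2 (0) = a`; assume the four
representatives `(a, z) ↦ sec₀ ξₐ z, sec₁ ξₐ w, sec₀ fₐ z, sec₁ fₐ w` are jointly `C^∞` on
`ball 0 ε × ℂ`. Then `CoreFor 𝒥` holds (with a possibly smaller `ε`). [cite: Wendl2018, Thm. 2.46] -/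
theorem coreFor_of_family (hr1 : r < 1) {ε : ℝ} (hε : 0 < ε) (γ : ℂ → SecPair k r)
    (hγ0 : γ 0 = 0) (hγc : ContinuousAt γ 0)
    (hsmall : ∀ a ∈ ball (0 : ℂ) ε, Small hr1.le k (γ a))
    (hsol : ∀ a ∈ ball (0 : ℂ) ε, 𝒥.FT hr1.le k (γ a) = 0 ∧ 𝒥.FN hr1.le k (γ a) = 0 ∧
      eval₀CLM (F := ℂ) (1 : ℂ → ℂ) (k + 1) r 0 (γ a).2 = a)
    (hjΞ₀ : ContDiffOn ℝ ∞ (fun q : ℂ × ℂ => sec₀ (fun w : ℂ => -w ^ 2) (γ q.1).1.1 q.2)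
      (ball 0 ε ×ˢ univ))
    (hjΞ₁ : ContDiffOn ℝ ∞ (fun q : ℂ × ℂ => sec₁ (fun w : ℂ => -w ^ 2) (γ q.1).1.1 q.2)
      (ball 0 ε ×ˢ univ))
    (hjΦ₀ : ContDiffOn ℝ ∞ (fun q : ℂ × ℂ => sec₀ (1 : ℂ → ℂ) (γ q.1).2.1 q.2) (ball 0 ε ×ˢ univ))
    (hjΦ₁ : ContDiffOn ℝ ∞ (fun q : ℂ × ℂ => sec₁ (1 : ℂ → ℂ) (γ q.1).2.1 q.2) (ball 0 ε ×ˢ univ)) :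
    𝒥.CoreFor := by
  -- invertibility thresholds of the two transports
  obtain ⟨δ₀, hδ₀, hU₀⟩ := 𝒥.exists_pos_isUnit_PhiJet₀
  obtain ⟨δ₁, hδ₁, hU₁⟩ := 𝒥.exists_pos_isUnit_PhiJet₁
  set δm : ℝ := min δ₀ δ₁ with hδm
  have hδm0 : 0 < δm := lt_min hδ₀ hδ₁
  -- shrink `ε` so that all four cut-off representatives have norm `< δm`
  have hTξ := eventually_norm_comp_lt hγc hγ0
    ((cutSec₀CLM neg_sq_clutch_ne_zero contDiffOn_neg_sq_clutch hr1.le).comp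
      (ContinuousLinearMap.fst ℝ _ (holderSections ℂ (1 : ℂ → ℂ) (k + 1) r))) hδm0
  have hTξ' := eventually_norm_comp_lt hγc hγ0
    ((cutSec₁CLM (τ := fun w : ℂ => -w ^ 2) contDiffOn_neg_sq_clutch hr1.le).comp
      (ContinuousLinearMap.fst ℝ _ (holderSections ℂ (1 : ℂ → ℂ) (k + 1) r))) hδm0
  have hTf := eventually_norm_comp_lt hγc hγ0
    ((cutSec₀CLM one_clutch_ne_zero contDiffOn_one_clutch hr1.le).comp
      (ContinuousLinearMap.snd ℝ (holderSections ℂ (fun w : ℂ => -w ^ 2) (k + 1) r) _)) hδm0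
  have hTf' := eventually_norm_comp_lt hγc hγ0
    ((cutSec₁CLM (τ := (1 : ℂ → ℂ)) contDiffOn_one_clutch hr1.le).comp
      (ContinuousLinearMap.snd ℝ (holderSections ℂ (fun w : ℂ => -w ^ 2) (k + 1) r) _)) hδm0
  obtain ⟨ε₁, hε₁, hball⟩ := Metric.eventually_nhds_iff_ball.1 ((hTξ.and hTξ').and (hTf.and hTf'))
  set ε' : ℝ := min ε ε₁ with hε'
  have hε'0 : 0 < ε' := lt_min hε hε₁
  have hε'ε : ∀ {a : ℂ}, ‖a‖ < ε' → a ∈ ball (0 : ℂ) ε := fun ha =>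
    mem_ball_zero_iff.2 (ha.trans_le (min_le_left _ _))
  have hε'₁ : ∀ {a : ℂ}, ‖a‖ < ε' → a ∈ ball (0 : ℂ) ε₁ := fun ha =>
    mem_ball_zero_iff.2 (ha.trans_le (min_le_right _ _))
  -- the four representatives
  refine ⟨ε', fun a z => sec₀ (fun w : ℂ => -w ^ 2) (γ a).1.1 z,
    fun a w => sec₁ (fun w : ℂ => -w ^ 2) (γ a).1.1 w, fun a z => sec₀ (1 : ℂ → ℂ) (γ a).2.1 z,
    fun a w => sec₁ (1 : ℂ → ℂ) (γ a).2.1 w, hε'0, ?_, ?_, ?_, ?_, ?_, ?_, ?_, ?_⟩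
  · -- zero at `a = 0`
    intro z
    simp only [hγ0, Prod.fst_zero, Prod.snd_zero, sec₀_coe_zero, sec₁_coe_zero, and_self]
  · -- clutching
    intro a _ w hw
    constructor
    · show sec₁ (fun w : ℂ => -w ^ 2) (γ a).1.1 w = -w ^ 2 * sec₀ (fun w : ℂ => -w ^ 2) (γ a).1.1 w⁻¹
      rw [sec₁_eq_smul_sec₀ (γ a).1.2 neg_sq_clutch_ne_zero hw, smul_eq_mul]
    · show sec₁ (1 : ℂ → ℂ) (γ a).2.1 w = sec₀ (1 : ℂ → ℂ) (γ a).2.1 w⁻¹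
      rw [sec₁_eq_smul_sec₀ (γ a).2.2 one_clutch_ne_zero hw, Pi.one_apply, one_smul]
  · exact hjΞ₀.mono (prod_mono (ball_subset_ball (min_le_left _ _)) Subset.rfl)
  · exact hjΞ₁.mono (prod_mono (ball_subset_ball (min_le_left _ _)) Subset.rfl)
  · exact hjΦ₀.mono (prod_mono (ball_subset_ball (min_le_left _ _)) Subset.rfl)
  · exact hjΦ₁.mono (prod_mono (ball_subset_ball (min_le_left _ _)) Subset.rfl)
  · -- smallness and the Cauchy–Riemann equations on the discs of radius `2`
    intro a ha
    have hsm := hsmall a (hε'ε ha)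
    obtain ⟨hT, hN, -⟩ := hsol a (hε'ε ha)
    obtain ⟨h0, h1⟩ := 𝒥.out_eq_zero_of_FT_FN hsm hT hN
    obtain ⟨⟨hbξ, hbξ'⟩, ⟨hbf, hbf'⟩⟩ := hball a (hε'₁ ha)
    simp only [ContinuousLinearMap.coe_comp, Function.comp_apply, ContinuousLinearMap.coe_fst',
      ContinuousLinearMap.coe_snd'] at hbξ hbξ' hbf hbf'
    constructor
    · intro z hz
      have hz3 : ‖z‖ ≤ 3 := hz.trans (by norm_num)
      have hz4 : ‖z‖ ≤ 4 := hz.trans (by norm_num)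
      refine ⟨(norm_sec₀_lt_of_small hsm hz4).trans (by norm_num), ?_⟩
      refine 𝒥.crExpr_eq_zero_of_crOp₀ hU₀ hz3 ?_ ?_
        (𝒥.crOp₀_eq_zero_of_out₀ hsm h0 (hz.trans_lt (by norm_num)))
      · exact (norm_sec₀_lt_of_cutSec₀CLM _ _ hr1.le _ hbξ hz4).trans_le (min_le_left _ _)
      · exact (norm_sec₀_lt_of_cutSec₀CLM _ _ hr1.le _ hbf hz4).trans_le (min_le_left _ _)
    · intro w hw
      have hw3 : ‖w‖ ≤ 3 := hw.trans (by norm_num)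
      have hw4 : ‖w‖ ≤ 4 := hw.trans (by norm_num)
      refine ⟨(norm_sec₁_lt_of_small hsm hw4).trans (by norm_num), ?_⟩
      refine 𝒥.crExpr_eq_zero_of_crOp₁ hU₁ hw3 ?_ ?_
        (𝒥.crOp₁_eq_zero_of_out₁ hsm h1 (hw.trans_lt (by norm_num)))
      · exact (norm_sec₁_lt_of_cutSec₁CLM _ hr1.le _ hbξ' hw4).trans_le (min_le_right _ _)
      · exact (norm_sec₁_lt_of_cutSec₁CLM _ hr1.le _ hbf' hw4).trans_le (min_le_right _ _)
  · -- the border condition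
    intro a ha
    obtain ⟨-, -, hev⟩ := hsol a (hε'ε ha)
    rwa [eval₀CLM_eq_sec₀ (by simp)] at hev

end SphereACData

end SphereCR

end Literature.Geometry.Symplectic

end
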